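import Summits.CriticalPhenomena.SAWScalingLimit.Theorems.SAWLeftRightFKGLeftRightFKGStubEndpointMonotone
import HarnessLib

/-!
# Stub `stub_chebyshev` of line `corner-localisation`: one-ended monotonicity gives PA

Crux `LeftRightFKG` (stmt-CriticalPhenomena-11232); vocabulary module `…LeftRightFKGDefs`; reused
machinery of the sibling stub `stub_endpointMonotone`: `…StubEndpointMonotoneAux` (abstract
finite sums: `bi_of_const`, `filter₂_congr`, `filter₃_congr`, the dictionary `μx_bi_iff`),
`…StubEndpointMonotoneAux2` (chords: `lt_length_of_ne`, `filter_restrP_nextDet`,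
`restrP_eq_succ_left`, `cls_succ_left_subset`, the potential lemmas `pot_lt_of_subset`,
`pot_lt_succ_left`) and `…StubEndpointMonotone` (`threshold_left`).

THE OUTER (HARRIS / TWO-POINT CHEBYSHEV) INDUCTION `EndMonoToPA`: inside one finite chord type,
given the next-step ranking of `StepMonotone` and one-ended monotonicity `PAfor x true false`
("`P(U | Γ ∩ E) ≥ P(U | Γ ∖ E)` for a next-step-determined relative up-set `E` and any relative
up-set `U`"), the full PA inequality `μ(AΓ) μ(BΓ) ≤ μ(Γ) μ(ABΓ)` for all pairs of relative up-sets,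
by strong induction on the potential `Φ(Γ) = Σ_{γ ∈ Γ} ((|γ| - k) + (|γ| - m))` of
`Γ = restrP k π m σ Sa Sb`: if `A` is constant on `Γ` the inequality is trivial (`bi_of_const`);
otherwise all chords of `Γ` are longer than `k` (`lt_length_of_ne`); if they share the next step,
re-describe `Γ` with the longer prefix (`Φ` drops, `pot_lt_succ_left`); else threshold the
next-step rank (`threshold_left`) to split `Γ = Γ₁ ⊔ Γ₂` by a next-step-determined relative
up-set `Q`, apply the induction hypothesis on `Γ₁`, `Γ₂` (`Φ` drops, `pot_lt_of_subset`) and the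
hypothesis with `(Q, A)` and `(Q, B)`, and conclude by the two-point Chebyshev sum inequality
`cheb` (real algebra, division-free). No topology: `lr` enters only through `IsUpOn` and the
monotone ranking.
-/

noncomputable section

open Finset SimpleGraph
open Literature.Probability.LatticeModels Literature.Probability.RandomPlanarGeometry
open scoped Classical

namespace Summit.CriticalPhenomena.SAWScalingLimit.Theorems.LeftRightFKG.CornerLoc

namespace Chebyshev

open EndpointMonotone

/-! ## The real-algebra lemma -/

/-- TWO-POINT CHEBYSHEV (division-free). Two blocks of masses `z₁, z₂ > 0` with sub-masses
`aᵢ` (of `A`), `bᵢ` (of `B`), `cᵢ` (of `A ∩ B`); hypotheses: PA inside each block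
(`aᵢ bᵢ ≤ zᵢ cᵢ`) and both `A` and `B` are denser in block 1 than in block 2
(`z₁ a₂ ≤ z₂ a₁`, `z₁ b₂ ≤ z₂ b₁`). Conclusion: PA for the union,
`(a₁ + a₂)(b₁ + b₂) ≤ (z₁ + z₂)(c₁ + c₂)`. Proof: `z₁ z₂ · (RHS - LHS)` is the sum of the five
nonnegative terms `z₁z₂(z₁c₁ - a₁b₁)`, `z₁z₂(z₂c₂ - a₂b₂)`, `z₁²(z₂c₂ - a₂b₂)`, `z₂²(z₁c₁ - a₁b₁)`,
`(z₂a₁ - z₁a₂)(z₂b₁ - z₁b₂)`. [cite: Harris1960, Lemma 4.1] -/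
theorem cheb {z₁ z₂ a₁ a₂ b₁ b₂ c₁ c₂ : ℝ} (hz₁ : 0 < z₁) (hz₂ : 0 < z₂)
    (h₁ : a₁ * b₁ ≤ z₁ * c₁) (h₂ : a₂ * b₂ ≤ z₂ * c₂) (ha : z₁ * a₂ ≤ z₂ * a₁)
    (hb : z₁ * b₂ ≤ z₂ * b₁) : (a₁ + a₂) * (b₁ + b₂) ≤ (z₁ + z₂) * (c₁ + c₂) := by
  have hz : 0 < z₁ * z₂ := mul_pos hz₁ hz₂
  have key : z₁ * z₂ * ((z₁ + z₂) * (c₁ + c₂) - (a₁ + a₂) * (b₁ + b₂)) =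
      z₁ * z₂ * (z₁ * c₁ - a₁ * b₁) + z₁ * z₂ * (z₂ * c₂ - a₂ * b₂) +
        z₁ ^ 2 * (z₂ * c₂ - a₂ * b₂) + z₂ ^ 2 * (z₁ * c₁ - a₁ * b₁) +
        (z₂ * a₁ - z₁ * a₂) * (z₂ * b₁ - z₁ * b₂) := by
    ring
  have hnonneg : 0 ≤ z₁ * z₂ * ((z₁ + z₂) * (c₁ + c₂) - (a₁ + a₂) * (b₁ + b₂)) := by
    rw [key]
    have := mul_nonneg hz.le (sub_nonneg.2 h₁)
    have := mul_nonneg hz.le (sub_nonneg.2 h₂)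
    have := mul_nonneg (sq_nonneg z₁) (sub_nonneg.2 h₂)
    have := mul_nonneg (sq_nonneg z₂) (sub_nonneg.2 h₁)
    have := mul_nonneg (sub_nonneg.2 ha) (sub_nonneg.2 hb)
    linarith
  have : z₁ * z₂ * ((a₁ + a₂) * (b₁ + b₂)) ≤ z₁ * z₂ * ((z₁ + z₂) * (c₁ + c₂)) := by
    linarith [hnonneg]
  exact le_of_mul_le_mul_left this hz

/-! ## The Chebyshev step on a weighted finite set -/

section Abstract

variable {ι : Type*}

/-- THE CHEBYSHEV STEP in abstract form. On a finite set `s` of items with positive weights, let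
`Q`, `Q'` be complementary on `s` and both met by `s`. From the block inequality
`BI(·; A, B)` : `w(· ∩ A) w(· ∩ B) ≤ w(·) w(· ∩ A ∩ B)` on the two halves `s ∩ Q`, `s ∩ Q'` and
the one-ended inequalities `BI(s; Q, A)`, `BI(s; Q, B)` (i.e. `A`, `B` are denser in `s ∩ Q`
than in `s ∩ Q'`) conclude `BI(s; A, B)`. [cite: Harris1960, Lemma 4.1] -/
theorem bi_cheb (s : Finset ι) (w : ι → ℝ) (Q Q' A B : Set ι) (hw : ∀ i ∈ s, 0 < w i)
    (hQ' : ∀ i ∈ s, (i ∈ Q' ↔ i ∉ Q)) (hq : ∃ i ∈ s, i ∈ Q) (hq' : ∃ i ∈ s, i ∈ Q')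
    (h₁ : (∑ i ∈ (s.filter (· ∈ Q)).filter (· ∈ A), w i) *
        (∑ i ∈ (s.filter (· ∈ Q)).filter (· ∈ B), w i) ≤
      (∑ i ∈ s.filter (· ∈ Q), w i) *
        ∑ i ∈ ((s.filter (· ∈ Q)).filter (· ∈ A)).filter (· ∈ B), w i)
    (h₂ : (∑ i ∈ (s.filter (· ∈ Q')).filter (· ∈ A), w i) *
        (∑ i ∈ (s.filter (· ∈ Q')).filter (· ∈ B), w i) ≤
      (∑ i ∈ s.filter (· ∈ Q'), w i) *
        ∑ i ∈ ((s.filter (· ∈ Q')).filter (· ∈ A)).filter (· ∈ B), w i)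
    (hA : (∑ i ∈ s.filter (· ∈ Q), w i) * (∑ i ∈ s.filter (· ∈ A), w i) ≤
      (∑ i ∈ s, w i) * ∑ i ∈ (s.filter (· ∈ Q)).filter (· ∈ A), w i)
    (hB : (∑ i ∈ s.filter (· ∈ Q), w i) * (∑ i ∈ s.filter (· ∈ B), w i) ≤
      (∑ i ∈ s, w i) * ∑ i ∈ (s.filter (· ∈ Q)).filter (· ∈ B), w i) :
    (∑ i ∈ s.filter (· ∈ A), w i) * (∑ i ∈ s.filter (· ∈ B), w i) ≤
      (∑ i ∈ s, w i) * ∑ i ∈ (s.filter (· ∈ A)).filter (· ∈ B), w i := by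
  have hw' : ∀ i ∈ s, 0 ≤ w i := fun i hi => (hw i hi).le
  -- the complement of `Q` on `s`
  have eQ' : s.filter (fun i => i ∉ Q) = s.filter (· ∈ Q') :=
    filter_congr fun i hi => (hQ' i hi).symm
  -- total mass
  have rs : ∑ i ∈ s, w i = (∑ i ∈ s.filter (· ∈ Q), w i) + ∑ i ∈ s.filter (· ∈ Q'), w i := by
    rw [← sum_filter_add_sum_filter_not s (· ∈ Q), eQ']
  -- mass of `A`
  have ra : ∑ i ∈ s.filter (· ∈ A), w i = (∑ i ∈ (s.filter (· ∈ Q)).filter (· ∈ A), w i) +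
      ∑ i ∈ (s.filter (· ∈ Q')).filter (· ∈ A), w i := by
    rw [← sum_filter_add_sum_filter_not (s.filter (· ∈ A)) (· ∈ Q)]
    congr 1
    · rw [filter₂_congr s (p₂ := (· ∈ Q)) (q₂ := (· ∈ A)) fun i _ => and_comm]
    · rw [filter₂_congr s (p₂ := (· ∈ Q')) (q₂ := (· ∈ A)) fun i hi => by
        rw [hQ' i hi]; exact and_comm]
  -- mass of `B`
  have rb : ∑ i ∈ s.filter (· ∈ B), w i = (∑ i ∈ (s.filter (· ∈ Q)).filter (· ∈ B), w i) +
      ∑ i ∈ (s.filter (· ∈ Q')).filter (· ∈ B), w i := by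
    rw [← sum_filter_add_sum_filter_not (s.filter (· ∈ B)) (· ∈ Q)]
    congr 1
    · rw [filter₂_congr s (p₂ := (· ∈ Q)) (q₂ := (· ∈ B)) fun i _ => and_comm]
    · rw [filter₂_congr s (p₂ := (· ∈ Q')) (q₂ := (· ∈ B)) fun i hi => by
        rw [hQ' i hi]; exact and_comm]
  -- mass of `A ∩ B`
  have rc : ∑ i ∈ (s.filter (· ∈ A)).filter (· ∈ B), w i =
      (∑ i ∈ ((s.filter (· ∈ Q)).filter (· ∈ A)).filter (· ∈ B), w i) +
        ∑ i ∈ ((s.filter (· ∈ Q')).filter (· ∈ A)).filter (· ∈ B), w i := by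
    rw [← sum_filter_add_sum_filter_not ((s.filter (· ∈ A)).filter (· ∈ B)) (· ∈ Q)]
    congr 1
    · rw [filter₃_congr s (p₂ := (· ∈ Q)) (q₂ := (· ∈ A)) (r₂ := (· ∈ B)) fun i _ => by tauto]
    · rw [filter₃_congr s (p₂ := (· ∈ Q')) (q₂ := (· ∈ A)) (r₂ := (· ∈ B)) fun i hi => by
        rw [hQ' i hi]; tauto]
  -- both halves have positive mass
  have hz₁ : 0 < ∑ i ∈ s.filter (· ∈ Q), w i := by
    obtain ⟨i, hi, hiQ⟩ := hq
    exact lt_of_lt_of_le (hw i hi) (single_le_sum (fun j hj => hw' j (filter_subset _ _ hj))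
      (mem_filter.2 ⟨hi, hiQ⟩))
  have hz₂ : 0 < ∑ i ∈ s.filter (· ∈ Q'), w i := by
    obtain ⟨i, hi, hiQ'⟩ := hq'
    exact lt_of_lt_of_le (hw i hi) (single_le_sum (fun j hj => hw' j (filter_subset _ _ hj))
      (mem_filter.2 ⟨hi, hiQ'⟩))
  rw [ra, rs] at hA
  rw [rb, rs] at hB
  rw [rc, ra, rb, rs]
  exact cheb hz₁ hz₂ h₁ h₂ (by linarith [hA]) (by linarith [hB])

end Abstract

/-! ## The induction -/

variable {Ω : Set ℂ} {δ : ℝ} {a b : Site 2}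

/-- THE HARRIS INDUCTION. For a finite chord type with fugacity `x > 0`, the next-step ranking
`hRN` of `StepMonotone` and one-ended monotonicity `hE` in real block form (`BI(Γ; E, U)` for
every `Γ = restrP k π m σ Sa Sb`, every next-step-determined relative up-set `E` and every
relative up-set `U`): for every `Γ` (by strong induction on its potential) and all relative
up-sets `A`, `B` of the class, `BI(Γ; A, B)`. [cite: Harris1960, Lemma 4.1] -/
theorem bi_of_endMono [Fintype (SAW.DomainSAW Ω δ a b)] {x : ℝ} (hx : 0 < x)
    (hRN : ∀ (k : ℕ) (π : ℕ → Site 2), ∃ r : Site 2 → ℕ,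
      Set.InjOn r ((zdGraph 2).neighborSet (π k)) ∧
      ∀ γ₁ γ₂ : SAW.DomainSAW Ω δ a b, AgreeTo k π γ₁ → AgreeTo k π γ₂ → lr γ₁ γ₂ →
        r (γ₁.walk.getVert (k + 1)) ≤ r (γ₂.walk.getVert (k + 1)))
    (hE : ∀ (k : ℕ) (π : ℕ → Site 2) (m : ℕ) (σ : ℕ → Site 2) (Sa Sb : Set (Site 2))
      (E U : Set (SAW.DomainSAW Ω δ a b)) (s : Finset (SAW.DomainSAW Ω δ a b)),
      s = univ.filter (· ∈ restrP k π m σ Sa Sb) → IsUpOn (cls k π m σ) E →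
      IsUpOn (cls k π m σ) U → NextDet k E →
      (∑ γ ∈ s.filter (· ∈ E), x ^ γ.length) * (∑ γ ∈ s.filter (· ∈ U), x ^ γ.length) ≤
        (∑ γ ∈ s, x ^ γ.length) * ∑ γ ∈ (s.filter (· ∈ E)).filter (· ∈ U), x ^ γ.length)
    (n : ℕ) :
    ∀ (k : ℕ) (π : ℕ → Site 2) (m : ℕ) (σ : ℕ → Site 2) (Sa Sb : Set (Site 2))
      (s : Finset (SAW.DomainSAW Ω δ a b)), s = univ.filter (· ∈ restrP k π m σ Sa Sb) →
      ∑ γ ∈ s, ((γ.length - k) + (γ.length - m)) = n →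
      ∀ A B : Set (SAW.DomainSAW Ω δ a b), IsUpOn (cls k π m σ) A → IsUpOn (cls k π m σ) B →
        (∑ γ ∈ s.filter (· ∈ A), x ^ γ.length) * (∑ γ ∈ s.filter (· ∈ B), x ^ γ.length) ≤
          (∑ γ ∈ s, x ^ γ.length) * ∑ γ ∈ (s.filter (· ∈ A)).filter (· ∈ B), x ^ γ.length := by
  induction n using Nat.strong_induction_on with
  | h n ih =>
  intro k π m σ Sa Sb s hs hΦ A B hA hB
  have hw : ∀ γ ∈ s, 0 < x ^ γ.length := fun γ _ => pow_pos hx _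
  have hw' : ∀ γ ∈ s, 0 ≤ x ^ γ.length := fun γ _ => pow_nonneg hx.le _
  have hmem : ∀ γ, γ ∈ s ↔ γ ∈ restrP k π m σ Sa Sb := fun γ => by simp [hs]
  have hcls : ∀ γ ∈ s, γ ∈ cls k π m σ := fun γ hγ => ((hmem γ).1 hγ).1
  -- two distinct chords make every chord of `s` long
  have hlong : ∀ γ₁ ∈ s, ∀ γ₂ ∈ s, γ₁ ≠ γ₂ → ∀ γ ∈ s, k < γ.length ∧ m < γ.length := by
    intro γ₁ h₁ γ₂ h₂ hne γ hγ
    by_cases h : γ = γ₁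
    · subst h
      exact lt_length_of_ne (hcls _ hγ) (hcls _ h₂) hne
    · exact lt_length_of_ne (hcls _ hγ) (hcls _ h₁) h
  by_cases htriv : ∀ γ₁ ∈ s, ∀ γ₂ ∈ s, (γ₁ ∈ A ↔ γ₂ ∈ A)
  · exact bi_of_const s _ A B hw' htriv
  obtain ⟨γe, hγe, hγeA, γn, hγn, hγnA⟩ : ∃ γe ∈ s, γe ∈ A ∧ ∃ γn ∈ s, γn ∉ A := by
    by_contra hex
    refine htriv fun γ₁ hγ₁ γ₂ hγ₂ => ⟨fun h1 => ?_, fun h2 => ?_⟩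
    · by_contra h2
      exact hex ⟨γ₁, hγ₁, h1, γ₂, hγ₂, h2⟩
    · by_contra h1
      exact hex ⟨γ₂, hγ₂, h2, γ₁, hγ₁, h1⟩
  have hen : γe ≠ γn := fun h => hγnA (h ▸ hγeA)
  have hlen := hlong γe hγe γn hγn hen
  by_cases hW : ∀ γ ∈ s, γ.walk.getVert (k + 1) = γe.walk.getVert (k + 1)
  · -- all chords share the next step: re-describe with the longer prefix
    have hset := restrP_eq_succ_left ((hmem γe).1 hγe) fun γ hγ => hW γ ((hmem γ).2 hγ)
    have hsub := cls_succ_left_subset (hcls γe hγe)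
    have hs' : s = univ.filter (· ∈ restrP (k + 1) (fun i => γe.walk.getVert i) m σ
        Set.univ Sb) := by rw [hs, hset]
    have hlt : ∑ γ ∈ s, ((γ.length - (k + 1)) + (γ.length - m)) < n :=
      hΦ ▸ pot_lt_succ_left ⟨γe, hγe⟩ fun γ hγ => (hlen γ hγ).1
    exact ih _ hlt (k + 1) _ m σ Set.univ Sb s hs' rfl A B (hA.mono hsub) (hB.mono hsub)
  · -- two next steps: threshold event `Q`, split `s` and apply Chebyshev
    push Not at hW
    obtain ⟨γ', hγ', hX'⟩ := hW
    obtain ⟨Q, Q', hQd, hQ'd, hQup, hQQ', ⟨γq, hγq, hγqQ⟩, ⟨γq', hγq', hγq'Q⟩⟩ :=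
      threshold_left (hRN k π) s hcls (fun γ hγ => (hlen γ hγ).1) ⟨γ', hγ', γe, hγe, hX'⟩
    have hcolQ := by
      have e := filter_restrP_nextDet (π := π) (m := m) (σ := σ) (Sa := Sa) (Sb := Sb) hQd
      rw [← hs] at e
      refine e ▸ ih _ ?_ k π m σ _ Sb _ rfl rfl A B hA hB
      rw [← hΦ, ← e]
      exact pot_lt_of_subset (filter_subset _ _) hγq'
        (fun h => (hQQ' γq').1 hγq'Q (Finset.mem_filter.1 h).2) (hlen γq' hγq').1
    have hcolQ' := by
      have e := filter_restrP_nextDet (π := π) (m := m) (σ := σ) (Sa := Sa) (Sb := Sb) hQ'd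
      rw [← hs] at e
      refine e ▸ ih _ ?_ k π m σ _ Sb _ rfl rfl A B hA hB
      rw [← hΦ, ← e]
      exact pot_lt_of_subset (filter_subset _ _) hγq
        (fun h => (hQQ' γq).1 (Finset.mem_filter.1 h).2 hγqQ) (hlen γq hγq).1
    exact bi_cheb s _ Q Q' A B hw (fun γ _ => hQQ' γ) ⟨γq, hγq, hγqQ⟩ ⟨γq', hγq', hγq'Q⟩
      hcolQ hcolQ' (hE k π m σ Sa Sb Q A s hs hQup hA hQd) (hE k π m σ Sa Sb Q B s hs hQup hB hQd)

/-! ## The main theorem -/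

/-- ONE-ENDED MONOTONICITY GIVES POSITIVE ASSOCIATION (`EndMonoToPA`): under `StepMonotone`, for
every fugacity `x > 0`, `PAfor x true false` implies `PA x` — for every crux instance, by the
Harris induction `bi_of_endMono` inside the finite chord type, through the dictionary `μx_bi_iff`
between the measure form and the real block form. [cite: Harris1960, Lemma 4.1] -/
theorem endMonoToPA : EndMonoToPA := by
  intro hSM x hx hEM δ c a b a' b' C hI k π m σ Sa Sb A B hA hB _ _
  obtain ⟨hfin, hRN, -⟩ := hSM δ c a b a' b' C hI
  haveI : Fintype (SAW.DomainSAW (dom C δ) δ a b) := Fintype.ofFinite _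
  have hE' := fun k π m σ Sa Sb (E U : Set (SAW.DomainSAW (dom C δ) δ a b))
      (s : Finset (SAW.DomainSAW (dom C δ) δ a b))
      (hs : s = univ.filter (· ∈ restrP k π m σ Sa Sb))
      (hE : IsUpOn (cls k π m σ) E) (hU : IsUpOn (cls k π m σ) U) (hN : NextDet k E) => by
    have h := (μx_bi_iff hx.le E U (restrP k π m σ Sa Sb)).1
      (hEM δ c a b a' b' C hI k π m σ Sa Sb E U hE hU (fun _ => hN)
        fun h => absurd h Bool.false_ne_true)
    rw [← hs] at h
    exact h
  rw [μx_bi_iff hx.le]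
  exact bi_of_endMono hx hRN hE' _ k π m σ Sa Sb _ rfl rfl A B hA hB

end Chebyshev

/-- REGISTERED STUB `stub_chebyshev` of line `corner-localisation` (Harris/CIS outer induction,
fugacity-blind): given step-rank monotonicity, one-ended monotonicity at fugacity `x > 0`
propagates to full positive association at fugacity `x` (split `Γ` at the next free step by a
threshold next-step up-event, two-point Chebyshev). [cite: Harris1960, Lemma 4.1] -/
theorem stub_chebyshev : EndMonoToPA :=
  Chebyshev.endMonoToPA

end Summit.CriticalPhenomena.SAWScalingLimit.Theorems.LeftRightFKG.CornerLoc

end
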